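import Summits.HubbardSuperconductivity.HubbardSuperconductivity.Theorems.AnisotropyChordInsertionEntropyCoulombSheet
import Summits.HubbardSuperconductivity.HubbardSuperconductivity.Theorems.AnisotropyChordInsertionEntropyTeleDeconfinement

/-!
# Route `AnisotropyChord` / H0 rotor rung: the Coulomb-sheet Jastrow states are TELEPORTATION-DECONFINED (Part S
# currency) — unconditional (link between the kernel-generic resampling route and theory seat
# `hubbard-h0-rotor-theory-1`'s quantum-transfer interface, memo ROTOR-THEORY-9 §135(u)/§136)

* `jAmp_pos_comp_swap` (support of the canonical Jastrow state is closed under moves) and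
  `meanTeleLog_jAmp_ge_of_psd` (kernel-generic): `KernelPSDShift W D` ⟹ `−resamplingConst B D ≤ T(ψ_{W,N})` for the
  canonical Jastrow state of any even kernel `0 ≤ W ≤ B`, `W 0 = 0`, `2 ≤ N`, `2N ≤ |G| ≤ 3N`;
* `coulombSheetFamily β` (the half-filled Coulomb-sheet states as a family over all `L`) and
  **`coulombSheet_teleDeconfinedAlong` (UNCONDITIONAL):** for every `β ≥ 0`, `TeleDeconfinedAlong Even` holds for this
  family with `K = resamplingConst (50β) (50β)` — the property H0-T (conclusion side of «(S)+(K) ⇒ BEC») exhibited in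
  the `S(k) ≍ |k|` Jastrow class.
-/

set_option linter.dupNamespace false

noncomputable section

open Finset
open Literature.Probability.LatticeModels

namespace Summit.HubbardSuperconductivity.HubbardSuperconductivity.Theorems.AnisotropyChord.InsertionEntropy

section CoulombSheetDeconfined

variable {G : Type} [AddCommGroup G] [Fintype G] [DecidableEq G]

/-- The support of the canonical Jastrow state is closed under particle moves. [folklore] -/
theorem jAmp_pos_comp_swap (W : G → ℝ) (N : ℕ) (σ : G → Fin 2) (u v : G) (h : 0 < jAmp W N σ) :
    0 < jAmp W N (σ ∘ Equiv.swap u v) := by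
  have hpc : particleCount σ = N := jAmp_support W N σ h.ne'
  have hZ : 0 < jastrowSectorWeight (fun p q : G => W (p - q)) N := jastrowSectorWeight_pos _ N ⟨σ, hpc⟩
  have hpc' : particleCount (σ ∘ Equiv.swap u v) = N := by rw [particleCount_comp_equiv]; exact hpc
  unfold jAmp
  exact jastrowSectorAmp_pos _ N hZ _ hpc'

/-- **PSD ⟹ teleportation deconfinement (PROVED, kernel-generic):** `−C(B,D) ≤ T(ψ_{W,N})`, `T` the mean teleportation
log-ratio of `…InsertionEntropyTeleTransfer`. [folklore] -/
theorem meanTeleLog_jAmp_ge_of_psd (W : G → ℝ) (hWe : ∀ z, W (-z) = W z) (hW0 : W 0 = 0)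
    (hWnn : ∀ z, 0 ≤ W z) {B : ℝ} (hWB : ∀ z, W z ≤ B) (N : ℕ) (hN2 : 2 ≤ N) (h2N : 2 * N ≤ Fintype.card G)
    (h3N : Fintype.card G ≤ 3 * N) {D : ℝ} (hD : 0 ≤ D) (hPSD : KernelPSDShift W D) :
    -(resamplingConst B D) ≤ meanTeleLog (jAmp W N) N := by
  have hNle : N ≤ Fintype.card G := by omega
  have hZ := jastrowSectorWeight_jAmp_pos W N hNle
  have hB0 : 0 ≤ B := (hWnn 0).trans (hWB 0)
  have hEF := jastrowEnergyFloor_of_psd W hWe N D hD (by omega) hPSD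
  have hT0 := jastrowParticleHoleFloor_of_energyFloor W hWe hW0 hWnn N hN2 h2N h3N hD hEF
  have hsect : ∀ σ, jAmp W N σ ≠ 0 → ((univ.filter fun z => σ z = 0).card : ℝ) = (N : ℝ) := by
    intro σ hσ
    exact_mod_cast jAmp_support W N σ hσ
  refine meanTeleLog_ge_of_klDiv_le (jAmp W N) N _ ?_ (jastrowSectorAmp_nonneg _ _) (sum_jastrowSectorAmp_sq _ _ hZ)
    hsect (pairMass_symm_jAmp W N) (fun σ u v _ _ _ hσ => jAmp_pos_comp_swap W N σ u v hσ) ?_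
  · unfold resamplingConst; positivity
  · intro x y hxy
    unfold resamplingConst
    exact klDiv_jAmp_le_of_energyFloor W hWe hW0 hWnn hWB N hN2 h2N (by positivity) hD hT0 hEF x y hxy

/-- The half-filled Coulomb-sheet Jastrow states as a family over all torus sizes (junk value `0` at `L = 0`). [folklore] -/
def coulombSheetFamily (β : ℝ) : ∀ L : ℕ, (TorusSite 2 L → Fin 2) → ℝ :=
  fun L => if h : L = 0 then fun _ => 0 else
    haveI : NeZero L := ⟨h⟩
    jAmp (coulombSheetKernel L β) (L ^ 2 / 2)

/-- Unfolding the family at `L ≠ 0`. [folklore] -/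
theorem coulombSheetFamily_eq (β : ℝ) (L : ℕ) [NeZero L] :
    coulombSheetFamily β L = jAmp (coulombSheetKernel L β) (L ^ 2 / 2) := by
  unfold coulombSheetFamily
  rw [dif_neg (NeZero.ne L)]

/-- **TELEPORTATION DECONFINEMENT OF THE COULOMB-SHEET JASTROW STATES (UNCONDITIONAL):** for every `β ≥ 0`,
`TeleDeconfinedAlong Even (coulombSheetFamily β) (L ↦ ⌊L²/2⌋)` with constant `resamplingConst (50β) (50β)`. [folklore] -/
theorem coulombSheet_teleDeconfinedAlong {β : ℝ} (hβ : 0 ≤ β) :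
    TeleDeconfinedAlong Even (coulombSheetFamily β) (fun L => ((L ^ 2 / 2 : ℕ) : ℝ)) := by
  refine ⟨resamplingConst (50 * β) (50 * β), fun L _ hL _ => ?_⟩
  obtain ⟨h1, h2, h3⟩ := halfFilling_numerology L hL
  rw [coulombSheetFamily_eq]
  exact meanTeleLog_jAmp_ge_of_psd (coulombSheetKernel L β) (coulombSheetKernel_neg β) (coulombSheetKernel_zero β)
    (coulombSheetKernel_nonneg hβ) (coulombSheetKernel_le hβ) (L ^ 2 / 2) h1 h2 h3 (by positivity)
    (coulombSheetKernel_psd hβ)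

end CoulombSheetDeconfined

end Summit.HubbardSuperconductivity.HubbardSuperconductivity.Theorems.AnisotropyChord.InsertionEntropy
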